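import Summits.BirchSwinnertonDyer.Rank1Residual.AdditivePotMult.QuadraticBaseChangeDescentUnramifiedFactWithTwo
import Literature.NumberTheory.EllipticCurves.RootNumberTwistProofs
import HarnessLib

/-!
# The base-change-and-descend END with NO local hypothesis for the canonical field `|d_K| = p`
# (row T-MIL-3, FILE H-5c; seat n1011-p01 GEN 8)

HONEST FRAMING (cell `b2b-bsdres`, run/shared/lean/b2b/bsd-rank1-residual/, verbatim in every
file): the goal of the cell is to DELETE the COMBINATION-SHAPED residual classes of the
Birch–Swinnerton-Dyer formula for ALL analytic-rank `≤ 1` elliptic curves over `ℚ` — "full BSD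
formula for every rank `≤ 1` curve in class `C`" assembled STRICTLY from published theorems — so
that the rank-`≤ 1` remainder becomes exactly the CONSTRUCTION-SHAPED classes, which are TYPED
(missing-input `Prop`s), NOT attempted. This is not "finishing BSD". Sub-classes X3♯(M) / X4(M)
(additive, potentially multiplicative prime; base-change-and-descend): a RESEARCH ROUTE; they stay
CONSTRUCTION-SHAPED; nothing is booked by this file; no mark / label moved. THEOREMS ONLY: no
definition, no named fact, no `sorry`.

## What

FILE H-5b's in-class END `bsdp_of_pPartOver_of_bsdp_twist_quadratic_of_unramifiedFact_oddPrime_of_dvd_discr`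
descends at every odd `p ∣ d_K` under FILE G-1's S₃ hypothesis `hS`: `W` good ∨ multiplicative ∨
(`ℓ ∣ d_K` ∧ `W_d` multiplicative) ∨ (additive ∧ `ℓ ∤ d_K`) at every place. For THE canonical field of
the X3♯(M)/X4(M) descent — the quadratic field with `|d_K| = p`, i.e. `K = ℚ(√p*)` (`ℚ(√−3)` at
`p = 3`) — `p` is the ONLY ramified prime, so `hS` holds AUTOMATICALLY as soon as the twist
`W_d = C_d • W^{(d_K)}` is multiplicative at `p`: every other place is unramified and `W` is good,
multiplicative or additive there (tree trichotomy
`hasGoodReductionAt_or_hasMultiplicativeReductionAt_or_hasAdditiveReductionAt`). Also `d_K = ±p` is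
odd and squarefree for free. Hence:

* **`bsdp_of_pPartOver_of_bsdp_twist_quadratic_of_unramifiedFact_of_natAbs_discr` — for `[K:ℚ] = 2`
  with `|d_K| = p` odd, `W_d` multiplicative at `p` (`Mult Wd p`), `W' = C' • W_K` globally minimal,
  `r_an(W) + r_an(W_d) ≤ 1`: `BSDp W p ⟸ MissingPPartOverAt W' p ∧ BSDp Wd p`, hypotheses `hGZK`,
  `hmod`, `hA` (A233, W only) and NOTHING local** — no `hS`, no `hdodd`, no `hdsq`;
* `bsdp_of_classX4M_of_rankZero_twist_noMilne_of_unramifiedFact_of_natAbs_discr` — **X4(M)⁰ with the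
  canonical field: `BSD(E,p) ⇐ MissingPPartOverAt W' p`** for `(E,p) ∈ X4(M)` of analytic rank `≤ 1`,
  `|d_K| = p`, twist multiplicative at `p` of analytic rank `0` with (ram); inputs Skinner 2016 Thm. C
  (`hSk`), `hGZK`, `hmod`, `hA`;
* `bsdp_of_classX3M_of_rankZero_twist_noMilne_of_unramifiedFact_of_natAbs_discr` — X3♯(M)⁰ likewise,
  `⇐ MissingPPartOverAt W' p ∧ MissingLowerBoundAt Wd p` (Wuthrich 2014 Prop. 21 `hW`).

So for an X4(M) pair with its canonical field, once A233 is a theorem (row T-A233) the ONLY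
hypothesis of the class theorem that is not a published result is the typed over-`K` input
`MissingPPartOverAt(E_K, p)` — the located CONSTRUCTION-SHAPED gap (EVIDENCE of its size at
`p = 3`: census note `HOME/b2b-bsdres-n1011-p01/g8/CENSUS-X4M3-AT2.md`, 129 444 pairs `N < 5·10⁵`
with (ram), twist rank `0`, hS-ok; 137 447 with the inert-`2` `IV`/`IV*` entry).

HONEST LIMITS: CONDITIONAL on A233 (`hA`); `|d_K| = p` only (other admissible fields keep H-5b's
`hS`); total analytic rank `≤ 1`; twist of analytic rank `0` in the class twins; nothing asserts
(ram) or the twist's rank for a given pair; X3♯(M)/X4(M) stay CONSTRUCTION-SHAPED; TOOL/END theorems;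
closes no class; moves no mark.

References: J. S. Milne, Invent. Math. 17 (1972) [Milne1972ArithmeticAV]; C. Skinner, Pacific J.
Math. 283 (2016) Thm. C [Skinner2016PacificMC]; C. Wuthrich, Doc. Math. 19 (2014) Prop. 21
[Wuthrich2014]; J. H. Silverman, *AEC* Prop. VII.5.1, VII.5.4 (a) [SilvermanAEC2009];
R. L. Miller, LMS J. Comput. Math. 14 (2011) Def. 1.1 [Miller2011LMS].
-/

noncomputable section

open scoped Classical NumberField

open WeierstrassCurve NumberField NumberField.InfinitePlace IsDedekindDomain Rat.HeightOneSpectrum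
  Literature.NumberTheory.EllipticCurves Literature.NumberTheory.EllipticCurves.Rank1Residual
  Literature.NumberTheory.EllipticCurves.Rank1Residual.Typed
  Literature.NumberTheory.EllipticCurves.Wuthrich2014
  Literature.NumberTheory.DiophantineGeometry

namespace Summit.BirchSwinnertonDyer.Rank1Residual.AdditivePotMult

section PrimeDiscriminant

variable (W : WeierstrassCurve ℚ) [W.IsElliptic] [W.IsGloballyMinimal] (p : ℕ) [hp : Fact p.Prime]
  (K : Type) [Field K] [NumberField K]
  (Wd : WeierstrassCurve ℚ) [Wd.IsElliptic] [Wd.IsGloballyMinimal]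
  (W' : WeierstrassCurve K) [W'.IsElliptic] [W'.IsGloballyMinimal]

omit [W.IsElliptic] [W.IsGloballyMinimal] [Wd.IsGloballyMinimal] in
/-- **For `|d_K| = p` the local hypothesis `hS` of the descent is automatic** once the twist `W_d` is
multiplicative at `p`: `d_K = ±p` is odd and squarefree, and at every place `v`, either `ℓ_v = p`
(third disjunct: `p ∣ d_K`, and `Mult Wd p` transported to the place by the tree's
`hasMultiplicativeReductionAtPrime_iff_hasMultiplicativeReductionAt_ringOfIntegers`) or `ℓ_v ∤ d_K`,
`ℓ_v ≠ p` and `W` is good, multiplicative or additive at `v` (tree trichotomy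
`hasGoodReductionAt_or_hasMultiplicativeReductionAt_or_hasAdditiveReductionAt`); the clause
`p = 3 → ℓ_v ≠ 3` of H-5a/H-5b holds because `ℓ_v ≠ p`. [cite: SilvermanAEC2009, VII.5 Prop. 5.1] -/
theorem localHyp_of_natAbs_discr (hdK : (NumberField.discr K).natAbs = p) (hp2 : p ≠ 2)
    (hmult : Mult Wd p) :
    Odd (NumberField.discr K) ∧ Squarefree (NumberField.discr K) ∧
    ∀ v : HeightOneSpectrum (𝓞 ℚ), W.HasGoodReductionAt v ∨ W.HasMultiplicativeReductionAt v ∨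
      (((primesEquiv v : ℕ) : ℤ) ∣ NumberField.discr K ∧ Wd.HasMultiplicativeReductionAt v) ∨
      (W.HasAdditiveReductionAt v ∧ ¬ ((primesEquiv v : ℕ) : ℤ) ∣ NumberField.discr K ∧
        (p = 3 → (primesEquiv v : ℕ) ≠ 3)) := by
  have hpd : (p : ℤ) ∣ NumberField.discr K := Int.natCast_dvd.mpr (by rw [hdK])
  refine ⟨?_, ?_, fun v => ?_⟩
  · exact Int.natAbs_odd.mp (hdK ▸ hp.out.odd_of_ne_two hp2)
  · exact Int.squarefree_natAbs.mp (hdK ▸ hp.out.prime.squarefree)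
  · by_cases hv : (primesEquiv v : ℕ) = p
    · refine Or.inr (Or.inr (Or.inl ⟨by rw [hv]; exact hpd, ?_⟩))
      have hm : (haveI := Fact.mk (primesEquiv v).2
          Wd.HasMultiplicativeReductionAtPrime (primesEquiv v)) := by
        have h : Wd.HasMultiplicativeReductionAtPrime p := hmult
        subst hv
        exact h
      exact (Wd.hasMultiplicativeReductionAtPrime_iff_hasMultiplicativeReductionAt_ringOfIntegers v).mp hm
    · have hnd : ¬ ((primesEquiv v : ℕ) : ℤ) ∣ NumberField.discr K := by
        intro h
        have h' : (primesEquiv v : ℕ) ∣ (NumberField.discr K).natAbs := Int.natCast_dvd.mp h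
        rw [hdK] at h'
        exact hv ((Nat.prime_dvd_prime_iff_eq (primesEquiv v).2 hp.out).mp h')
      rcases W.hasGoodReductionAt_or_hasMultiplicativeReductionAt_or_hasAdditiveReductionAt v with
        h | h | h
      · exact Or.inl h
      · exact Or.inr (Or.inl h)
      · exact Or.inr (Or.inr (Or.inr ⟨h, hnd, fun hp3 hv3 => hv (by rw [hv3, hp3])⟩))

/-- **THE BASE-CHANGE-AND-DESCEND END FOR THE CANONICAL FIELD `|d_K| = p`, NO LOCAL HYPOTHESIS.**
`W/ℚ` globally minimal, `[K:ℚ] = 2` with `|d_K| = p` odd (so `K = ℚ(√p*)`), `W_d = C_d • W^{(d_K)}`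
globally minimal and MULTIPLICATIVE at `p` (`Mult Wd p` — the X3♯(M)/X4(M) situation), `W' = C' • W_K`
globally minimal, `r_an(W) + r_an(W_d) ≤ 1`, `hA` = A233 for `W`: **`BSDp W p ⟸ MissingPPartOverAt W' p
∧ BSDp Wd p`** with `hGZK`, `hmod` — H-5b's `…_oddPrime` with its `hS`, `hdodd`, `hdsq` all DISCHARGED
by `localHyp_of_natAbs_discr`. At `p ≥ 5` this is G-1's END specialised to `ℚ(√p*)` with no `hS`; at
`p = 3`, `K = ℚ(√−3)`, every Kodaira type at `2` included (T-MIL-B2 inside H-5a).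
[cite: Milne1972ArithmeticAV, §1 Thm. 1 and §2 (through DokchitserDokchitserAnnals2010, §2.1, proof of Thm. 8)]
[cite: SilvermanAEC2009, Prop. VII.5.4 (a)] [cite: Miller2011LMS, Def. 1.1 (arXiv:1010.2431 p. 3)] -/
theorem bsdp_of_pPartOver_of_bsdp_twist_quadratic_of_unramifiedFact_of_natAbs_discr
    (hGZK : rank_eq_analyticRank_of_analyticRank_le_one) (hmod : hasEntireLFunction_rat)
    (h2 : Module.finrank ℚ K = 2) (hdK : (NumberField.discr K).natAbs = p)
    {Cd : VariableChange ℚ} (hWd : Cd • W.quadraticTwist (NumberField.discr K : ℚ) = Wd)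
    {C' : VariableChange K} (hW' : C' • W.baseChange K = W')
    (hr : W.analyticRank + Wd.analyticRank ≤ 1)
    (hA : ∀ (v : HeightOneSpectrum (𝓞 ℚ)) (w : HeightOneSpectrum (𝓞 K)),
      kodairaSymbolAt_baseChange_of_ramificationIdx_eq_one K v w W)
    (hp2 : p ≠ 2) (hmult : Mult Wd p)
    (hK : MissingPPartOverAt W' p) (hd : BSDp Wd p) : BSDp W p := by
  obtain ⟨hdodd, hdsq, hS⟩ := localHyp_of_natAbs_discr W p K Wd hdK hp2 hmult
  exact bsdp_of_pPartOver_of_bsdp_twist_quadratic_of_unramifiedFact_oddPrime W p K Wd W' hGZK hmod h2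
    hdodd hdsq hWd hW' hr hA hp2 hS hK hd

/-- **X4(M)⁰ WITH THE CANONICAL FIELD `|d_K| = p`: `BSD(E, p) ⇐ MissingPPartOverAt W' p`, NO local
hypothesis, NO Milne.** For `(E,p) ∈ X4(M)` (odd additive `p`, `E[p]` irreducible, `ord_p j < 0`) of
analytic rank `≤ 1`, the quadratic field `K` with `|d_K| = p`, its twist `Wd = C_d • W^{(d_K)}`
MULTIPLICATIVE at `p`, of analytic rank `0`, with (ram), a globally minimal `K`-model `W' = C' • W_K`,
and A233 as `hA`: `BSD(E,p)` follows from `MissingPPartOverAt W' p` ALONE, the other inputs being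
Skinner 2016 Thm. C (`hSk`: the twist is COVERED), `hGZK`, `hmod`, `hA`. Nothing asserts that the twist
is multiplicative of rank `0` with (ram) for a given pair (census bits).
[cite: Skinner2016PacificMC, Thm. C (§1), footnote 1, §2.5]
[cite: Milne1972ArithmeticAV, §1 Thm. 1 and §2 (through DokchitserDokchitserAnnals2010, §2.1, proof of Thm. 8)]
[cite: SilvermanAEC2009, Prop. VII.5.4 (a)] -/
theorem bsdp_of_classX4M_of_rankZero_twist_noMilne_of_unramifiedFact_of_natAbs_discr
    (hGZK : rank_eq_analyticRank_of_analyticRank_le_one) (hmod : hasEntireLFunction_rat)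
    (hSk : Skinner2016.thmC_padicValRat_bsd_rank_zero)
    (hX : ClassX4M W p) (hr : W.analyticRank ≤ 1) (h2 : Module.finrank ℚ K = 2)
    (hdK : (NumberField.discr K).natAbs = p)
    {Cd : VariableChange ℚ} (hWd : Cd • W.quadraticTwist (NumberField.discr K : ℚ) = Wd)
    (hmult : Mult Wd p) (hram : Ram Wd p) (hr0 : Wd.analyticRank = 0)
    {C' : VariableChange K} (hW' : C' • W.baseChange K = W')
    (hA : ∀ (v : HeightOneSpectrum (𝓞 ℚ)) (w : HeightOneSpectrum (𝓞 K)),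
      kodairaSymbolAt_baseChange_of_ramificationIdx_eq_one K v w W)
    (hK : MissingPPartOverAt W' p) : BSDp W p := by
  obtain ⟨hdodd, hdsq, hS⟩ := localHyp_of_natAbs_discr W p K Wd hdK hX.p_ne_two hmult
  exact bsdp_of_classX4M_of_rankZero_twist_noMilne_of_unramifiedFact_oddPrime W p K Wd W' hGZK hmod hSk
    hX hr h2 hdodd hdsq hWd hmult hram hr0 hW' hA hS hK

/-- **X3♯(M)⁰ WITH THE CANONICAL FIELD `|d_K| = p`:
`BSD(E,p) ⇐ MissingPPartOverAt W' p ∧ MissingLowerBoundAt Wd p`, NO local hypothesis, NO Milne.** For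
`(E,p) ∈ X3♯(M)` (odd additive Eisenstein `p`, `ord_p j < 0`) of analytic rank `≤ 1`, the quadratic
field `K` with `|d_K| = p`, its twist `Wd` MULTIPLICATIVE at `p` of analytic rank `0`, `W' = C' • W_K`
globally minimal, and A233 as `hA`: inputs Wuthrich 2014 Prop. 21 (`hW`, the upper half of the X2
input of the twist), `hGZK`, `hmod`, `hA`. [cite: Wuthrich2014, Prop. 21]
[cite: Milne1972ArithmeticAV, §1 Thm. 1 and §2 (through DokchitserDokchitserAnnals2010, §2.1, proof of Thm. 8)]
[cite: SilvermanAEC2009, Prop. VII.5.4 (a)] -/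
theorem bsdp_of_classX3M_of_rankZero_twist_noMilne_of_unramifiedFact_of_natAbs_discr
    (hGZK : rank_eq_analyticRank_of_analyticRank_le_one) (hmod : hasEntireLFunction_rat)
    (hW : sha_dvd_analyticSha)
    (hX : ClassX3M W p) (hr : W.analyticRank ≤ 1) (h2 : Module.finrank ℚ K = 2)
    (hdK : (NumberField.discr K).natAbs = p)
    {Cd : VariableChange ℚ} (hWd : Cd • W.quadraticTwist (NumberField.discr K : ℚ) = Wd)
    (hmult : Mult Wd p) (hr0 : Wd.analyticRank = 0)
    {C' : VariableChange K} (hW' : C' • W.baseChange K = W')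
    (hA : ∀ (v : HeightOneSpectrum (𝓞 ℚ)) (w : HeightOneSpectrum (𝓞 K)),
      kodairaSymbolAt_baseChange_of_ramificationIdx_eq_one K v w W)
    (hK : MissingPPartOverAt W' p) (hlow : MissingLowerBoundAt Wd p) : BSDp W p := by
  obtain ⟨hdodd, hdsq, hS⟩ := localHyp_of_natAbs_discr W p K Wd hdK hX.p_ne_two hmult
  exact bsdp_of_classX3M_of_rankZero_twist_noMilne_of_unramifiedFact_oddPrime W p K Wd W' hGZK hmod hW
    hX hr h2 hdodd hdsq hWd hmult hr0 hW' hA hS hK hlow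

end PrimeDiscriminant

end Summit.BirchSwinnertonDyer.Rank1Residual.AdditivePotMult

end
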